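import Mathlib

/-!
# DEQ-A223 receipt — exact recurrence of an equally spaced discretised band (OURS; DEQ-A223 §6)

HONEST FRAMING: instance-level adjudication of specific advantage claims; no claim about
BQP vs BPP or the summit.

Context (informal, not formalised).  Lang–Jain–Arrazola–Motlagh, arXiv:2601.16264v2, encode the
metallic continuum of a (generalised) Anderson–Newns model as `N_metal = 50–200` discrete orbitals
`ε_i` (their eq. (3)), one qubit each.  For a band of levels `ε_k = ε₀ + k·δ` the hybridisation
(memory) kernel of the band, `Δ(t) = Σ_k a_k · exp(-i ε_k t)` (`a_k = |w_k|² · f(ε_k)` or any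
weights), satisfies `Δ(t + T) = exp(-i ε₀ T) · Δ(t)` for `δ · T = 2π`, hence `‖Δ(t + T)‖ = ‖Δ(t)‖`:
the discretised band never forgets, while the continuum kernel decays.  A discretised-band
simulation is therefore faithful to the continuum only for `t ≲ t_rec = 2π/δ = 2π N/D`
(toy T42 of DEQ-A223 measures `t_dev / t_rec = 1.00–1.02` on the level population).  Only the
elementary trigonometric-sum identity is formalised; nothing about algorithms or complexity.
-/

noncomputable section

open Complex Finset

namespace Summit.QuantumAdvantage.Dequantization.BathRecurrence

/-- The discretised-band kernel `Δ(t) = Σ_{k<N} a_k · exp(-i (ε₀ + k δ) t)`. -/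
def kernel (N : ℕ) (a : ℕ → ℂ) (ε₀ δ : ℝ) (t : ℝ) : ℂ :=
  ∑ k ∈ range N, a k * exp (-(I * (ε₀ + k * δ) * t))

/-- One band level returns to itself after `T = 2π/δ` up to the common phase `exp(-i ε₀ T)`. -/
theorem level_phase_recur (k : ℕ) (ε₀ δ T t : ℝ) (hT : δ * T = 2 * Real.pi) :
    exp (-(I * (ε₀ + k * δ) * (t + T : ℝ))) =
      exp (-(I * ε₀ * T)) * exp (-(I * (ε₀ + k * δ) * t)) := by
  have h2 : exp (-(I * (k * δ) * T)) = 1 := by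
    have : -(I * ((k : ℂ) * (δ : ℂ)) * (T : ℂ)) = ((-(k : ℤ)) : ℂ) * (2 * Real.pi * I) := by
      have hT' : (δ : ℂ) * (T : ℂ) = 2 * Real.pi := by exact_mod_cast hT
      push_cast
      linear_combination (-(I * (k : ℂ))) * hT'
    rw [this]
    have h := Complex.exp_int_mul_two_pi_mul_I (-(k : ℤ))
    push_cast at h
    exact h
  rw [← Complex.exp_add, show -(I * (↑ε₀ + ↑k * ↑δ) * ((t + T : ℝ) : ℂ)) =
      -(I * ε₀ * T) + -(I * (ε₀ + k * δ) * t) + -(I * (k * δ) * T) by push_cast; ring,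
    Complex.exp_add, h2, mul_one]

/-- Exact quasi-periodicity of the equally spaced discretised band:
`Δ(t + T) = exp(-i ε₀ T) · Δ(t)` whenever `δ · T = 2π`. -/
theorem kernel_quasiPeriodic (N : ℕ) (a : ℕ → ℂ) (ε₀ δ T t : ℝ) (hT : δ * T = 2 * Real.pi) :
    kernel N a ε₀ δ (t + T) = exp (-(I * ε₀ * T)) * kernel N a ε₀ δ t := by
  unfold kernel
  rw [mul_sum]
  refine sum_congr rfl fun k _ => ?_
  rw [level_phase_recur k ε₀ δ T t hT]
  ring

/-- Hence the kernel's modulus recurs exactly with period `T = 2π/δ`: the discretised band has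
no long-time decay (in contrast with a continuum band, whose kernel tends to `0`). -/
theorem norm_kernel_periodic (N : ℕ) (a : ℕ → ℂ) (ε₀ δ T t : ℝ) (hT : δ * T = 2 * Real.pi) :
    ‖kernel N a ε₀ δ (t + T)‖ = ‖kernel N a ε₀ δ t‖ := by
  rw [kernel_quasiPeriodic N a ε₀ δ T t hT, norm_mul]
  have : ‖exp (-(I * ε₀ * T))‖ = 1 := by
    rw [show -(I * (ε₀ : ℂ) * (T : ℂ)) = ((-(ε₀ * T) : ℝ) : ℂ) * I by push_cast; ring]
    exact Complex.norm_exp_ofReal_mul_I _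
  rw [this, one_mul]

/-- In particular the kernel at every multiple of the recurrence time has the same modulus as at
`t = 0`, namely `‖Σ_k a_k‖` (total hybridisation weight): no finite equally spaced band relaxes. -/
theorem norm_kernel_at_multiples (N : ℕ) (a : ℕ → ℂ) (ε₀ δ T : ℝ) (hT : δ * T = 2 * Real.pi)
    (m : ℕ) : ‖kernel N a ε₀ δ (m * T)‖ = ‖∑ k ∈ range N, a k‖ := by
  induction m with
  | zero =>
    simp [kernel]
  | succ m ih =>
    rw [show ((m + 1 : ℕ) : ℝ) * T = m * T + T by push_cast; ring,
      norm_kernel_periodic N a ε₀ δ T _ hT, ih]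

end Summit.QuantumAdvantage.Dequantization.BathRecurrence

end
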